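import Summits.NavierStokesRegularity.FluidComputer.RiccatiSliceGen
import Summits.NavierStokesRegularity.FluidComputer.RiccatiInequality
import HarnessLib

/-!
# Fluid computer — support: the integrated Riccati inequality of the `Ḃ^s_{2,2}` rows, `3/2 < s < 5/2`

HONEST FRAMING (cell `pub-fluidc`, verbatim): *low prior, high value-of-information experiment on Tao's
machine paradigm; NOT a claim that NS blows up.* Support file (successor of `RiccatiInequality`, the case `s = 3/2`).
Along every maximal smooth solution `(u, p)` of the unforced Navier–Stokes system on `ℝ³ × [0, T)` (`ν > 0`) which is
Leray–Hopf from `u 0`, with `a_j(τ) = ‖Δ̇_j u(τ)‖₂` and `Y_κ(τ) = ∑_j 2^{κj} a_j(τ)²`, `κ = 2s`: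

* `hasBoundedSobolevNormsOn_fderiv_apply` — the Beale–Kato–Majda class is stable under `v ↦ ∂_m v`;
  `exists_fourthSum_le` — on every `[s, t] ⊂ (0, T)` the third derivatives of the first derivatives of the slices and
  the energy are UNIFORMLY bounded (Tao's persistence of regularity on the interior translate);
* `continuousOn_row` — `Y_κ` is continuous on every `[s, t] ⊂ (0, T)` for `1 ≤ κ ≤ 5`;
* `row_two_point_gen` (**THE RICCATI INEQUALITY AT WEIGHT `κ`, integrated; `3 < κ < 5`**) — one `K = K_κ > 0` with
  `Y_κ(t) − Y_κ(s) ≤ K ν^{−(5−κ)/(κ−1)} ∫_s^t Y_κ(τ)^{(κ+1)/(κ−1)} dτ` for all `0 < s ≤ t < T` — the integral form of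
  Cheskidov–Zaya's `y' ≲ y^{(2s+1)/(2s−1)}` (Remark 2.3), no infinite sum differentiated.

0 sorry; no definitions; no named facts.

## References

* A. Cheskidov, K. Zaya, J. Math. Phys. 57 (2016) 023101 = arXiv:1503.01784, Remark 2.3 (p. 6). [CheskidovZaya2016]
* T. Tao, Anal. PDE 6 (2013) = arXiv:1108.1165, Cor. 11.1. [Tao2011]
-/

noncomputable section

open MeasureTheory Set Function Filter Topology
open scoped ENNReal NNReal RealInnerProductSpace
open Literature.Analysis.FluidPDE Literature.Analysis.FunctionSpaces
open Literature.Analysis.FluidPDE.LPBounds (thirdSum)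
open Summit.NavierStokesRegularity.FluidComputer.BlockEnergyTransport
open Summit.NavierStokesRegularity.FluidComputer.BlockEnergyIdentity
open Summit.NavierStokesRegularity.FluidComputer.BlockEnergyContinuity
open Summit.NavierStokesRegularity.FluidComputer.RiccatiSlice
open Summit.NavierStokesRegularity.FluidComputer.RiccatiSliceGenTools
open Summit.NavierStokesRegularity.FluidComputer.RiccatiSliceGen
open Summit.NavierStokesRegularity.FluidComputer.RiccatiInequality

namespace Summit.NavierStokesRegularity.FluidComputer.RiccatiInequalityGen

/-! ## Uniform fourth-order data on interior windows -/

/-- **The Beale–Kato–Majda class is stable under a directional derivative**: if all `L²` Sobolev norms of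
`t ↦ v t` are bounded on `S` and the slices are smooth, then so are those of `t ↦ ∂_m (v t)` for a vector `m` with
`‖m‖ ≤ 1` (`‖Dⁿ(∂_m w)(x)‖ ≤ ‖m‖ ‖Dⁿ⁺¹ w(x)‖`). [folklore] -/
theorem hasBoundedSobolevNormsOn_fderiv_apply {S : Set ℝ}
    {v : ℝ → EuclideanSpace ℝ (Fin 3) → EuclideanSpace ℝ (Fin 3)} (hSob : HasBoundedSobolevNormsOn S v)
    (hcd : ∀ t ∈ S, ContDiff ℝ ((⊤ : ℕ∞) : WithTop ℕ∞) (v t)) {m : EuclideanSpace ℝ (Fin 3)} (hm : ‖m‖ ≤ 1) :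
    HasBoundedSobolevNormsOn S (fun t => fun x => fderiv ℝ (v t) x m) := by
  intro n
  obtain ⟨C, hC⟩ := hSob (n + 1)
  refine ⟨C, fun t ht => le_trans (lintegral_mono fun x => ?_) (hC t ht)⟩
  set L : (EuclideanSpace ℝ (Fin 3) →L[ℝ] EuclideanSpace ℝ (Fin 3)) →L[ℝ] EuclideanSpace ℝ (Fin 3) :=
    ContinuousLinearMap.apply ℝ (EuclideanSpace ℝ (Fin 3)) m with hL
  have hLn : ‖L‖ ≤ 1 := by
    refine ContinuousLinearMap.opNorm_le_bound _ zero_le_one fun g => ?_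
    rw [hL, ContinuousLinearMap.apply_apply, one_mul]
    exact (g.le_opNorm m).trans (mul_le_of_le_one_right (norm_nonneg _) hm)
  have hfd : ContDiff ℝ ((⊤ : ℕ∞) : WithTop ℕ∞) (fderiv ℝ (v t)) := (contDiff_infty_iff_fderiv.1 (hcd t ht)).2
  have h1 : ‖iteratedFDeriv ℝ n (L ∘ fderiv ℝ (v t)) x‖ ≤ ‖L‖ * ‖iteratedFDeriv ℝ n (fderiv ℝ (v t)) x‖ :=
    L.norm_iteratedFDeriv_comp_left hfd.contDiffAt (mod_cast le_top)
  rw [norm_iteratedFDeriv_fderiv] at h1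
  have h2 : ‖iteratedFDeriv ℝ n (fun x => fderiv ℝ (v t) x m) x‖ ≤ ‖iteratedFDeriv ℝ (n + 1) (v t) x‖ := by
    have e : (fun x => fderiv ℝ (v t) x m) = L ∘ fderiv ℝ (v t) := by
      funext y; simp [hL]
    rw [e]
    exact h1.trans (mul_le_of_le_one_left (norm_nonneg _) hLn)
  gcongr
  rw [← ofReal_norm, ← ofReal_norm]
  exact ENNReal.ofReal_le_ofReal h2

/-- **Uniform fourth-order data of an interior window.** For a maximal smooth solution `(u, p)` of the unforced system
on `ℝ³ × [0, T)` (`ν > 0`), Leray–Hopf from `u 0`, and `0 < s ≤ t < T`: there are `S₄, E₀` with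
`∑_i T₃(∂_i u(τ)) ≤ S₄` (`T₃ = LPBounds.thirdSum`) and `‖u(τ)‖₂ ≤ E₀` for every `τ ∈ [s, t]` — the interior translate is
in the Beale–Kato–Majda class (`GeometricFace.hasBoundedSobolevNormsOn_translate`), hence so are its first derivatives.
[cite: Tao2011, Cor. 11.1] -/
theorem exists_fourthSum_le {ν T : ℝ} (hν : 0 < ν) (hT : 0 < T)
    {u : ℝ → EuclideanSpace ℝ (Fin 3) → EuclideanSpace ℝ (Fin 3)} {p : ℝ → EuclideanSpace ℝ (Fin 3) → ℝ}
    (hmax : IsMaximalSmoothSolution ν 0 u p T) (hLH : IsLerayHopfOn T ν 0 (u 0) u)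
    {s t : ℝ} (hs : 0 < s) (hst : s ≤ t) (htT : t < T) :
    ∃ S₄ E₀ : ℝ≥0, ∀ τ ∈ Icc s t,
      ∑ i, thirdSum (fun x => fderiv ℝ (u τ) x (stdOrthonormalBasis ℝ (EuclideanSpace ℝ (Fin 3)) i)) ≤ S₄ ∧
        eLpNorm (u τ) 2 volume ≤ E₀ := by
  set e := stdOrthonormalBasis ℝ (EuclideanSpace ℝ (Fin 3)) with he
  have hsI : s ∈ Ioo 0 T := ⟨hs, hst.trans_lt htT⟩
  have hSob := GeometricFace.hasBoundedSobolevNormsOn_translate hν hT hmax hLH hsI (T'' := t - s) (by linarith)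
  have hcd : ∀ τ ∈ Icc 0 (t - s), ContDiff ℝ ((⊤ : ℕ∞) : WithTop ℕ∞) ((fun τ' => u (τ' + s)) τ) := fun τ hτ =>
    hmax.1.contDiff_velocity ⟨by linarith [hτ.1], by linarith [hτ.2]⟩
  have hsm : ∀ i, ∀ τ ∈ Icc 0 (t - s),
      IsSmoothL2Field ((fun τ' => fun x => fderiv ℝ ((fun τ'' => u (τ'' + s)) τ') x (e i)) τ) := fun i τ hτ =>
    (isSmoothL2Field_slice_of_maximal hν hT hmax hLH ⟨by linarith [hτ.1], by linarith [hτ.2]⟩).fderiv_apply (e i)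
  have hS : ∀ i, ∃ S₃ : ℝ≥0, ∀ τ ∈ Icc 0 (t - s),
      thirdSum (fun x => fderiv ℝ (u (τ + s)) x (e i)) ≤ S₃ := by
    intro i
    have hSob_i := hasBoundedSobolevNormsOn_fderiv_apply hSob hcd (m := e i) (by rw [e.orthonormal.1 i])
    obtain ⟨_, S₃, h⟩ := exists_gradSq_thirdSum_le hSob_i (hsm i)
    exact ⟨S₃, fun τ hτ => (h τ hτ).2⟩
  choose Sf hSf using hS
  obtain ⟨E₀, hE₀⟩ := exists_eLpNorm_slice_le hLH hν.le
  refine ⟨∑ i, Sf i, E₀, fun τ hτ => ⟨?_, hE₀ τ ⟨(hs.trans_le hτ.1).le, (hτ.2.trans_lt htT).le⟩⟩⟩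
  push_cast
  refine Finset.sum_le_sum fun i _ => ?_
  have h := hSf i (τ - s) ⟨by linarith [hτ.1], by linarith [hτ.2]⟩
  simpa only [sub_add_cancel] using h

/-! ## Time-continuity of the rows `Y_κ`, `1 ≤ κ ≤ 5` -/

/-- **Time-continuity of the `Ḃ^{κ/2}_{2,2}` row on interior windows** (`1 ≤ κ ≤ 5`): `τ ↦ ∑_j 2^{κj} ‖Δ̇_j u(τ)‖₂²` (as a
real number) is continuous on every `[s, t] ⊂ (0, T)` along a maximal smooth Leray–Hopf solution (the windows are
continuous and converge uniformly, the tails being at most `2^{−L}((C_r³C₂S₃)² + (C₂E₀)²)` there;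
`RiccatiInequality.continuousOn_besov32` is `κ = 3`). [folklore] -/
theorem continuousOn_row {κ : ℝ} (hκ1 : 1 ≤ κ) (hκ5 : κ ≤ 5) {ν T : ℝ} (hν : 0 < ν) (hT : 0 < T)
    {u : ℝ → EuclideanSpace ℝ (Fin 3) → EuclideanSpace ℝ (Fin 3)} {p : ℝ → EuclideanSpace ℝ (Fin 3) → ℝ}
    (hmax : IsMaximalSmoothSolution ν 0 u p T) (hLH : IsLerayHopfOn T ν 0 (u 0) u)
    {s t : ℝ} (hs : 0 < s) (hst : s ≤ t) (htT : t < T) :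
    ContinuousOn (fun τ => (∑' j : ℤ, (2 : ℝ≥0∞) ^ (κ * (j : ℝ)) * blockL2 (u τ) j ^ 2).toReal) (Icc s t) := by
  set K := lpBounds (Fin 3) with hK
  obtain ⟨S₃, E₀, hSE⟩ := exists_thirdSum_le hν hT hmax hLH hs hst htT
  set W : ℤ → ℝ≥0∞ := fun j => (2 : ℝ≥0∞) ^ (κ * (j : ℝ)) with hW
  set R : ℝ≥0∞ := ((K.Cr : ℝ≥0∞) ^ 3 * K.C₂ * S₃) ^ 2 + (K.C₂ * E₀) ^ 2 with hR
  set Y : ℝ → ℝ := fun τ => (∑' j : ℤ, W j * blockL2 (u τ) j ^ 2).toReal with hY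
  set F : ℕ → ℝ → ℝ := fun L τ => ∑ j ∈ Finset.Icc (-(L : ℤ)) L, (W j * blockL2 (u τ) j ^ 2).toReal with hF
  have hsub : Icc s t ⊆ Ioo 0 T := fun τ hτ => ⟨hs.trans_le hτ.1, hτ.2.trans_lt htT⟩
  have hw : ∀ τ ∈ Icc s t, IsSmoothL2Field (u τ) := fun τ hτ =>
    isSmoothL2Field_slice_of_maximal hν hT hmax hLH (hsub hτ)
  have hWtop : ∀ j, W j ≠ ∞ := fun j => RiccatiSlice.two_rpow_ne_top _
  have haj : ∀ τ ∈ Icc s t, ∀ j, blockL2 (u τ) j ^ 2 ≠ ∞ := fun τ hτ j =>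
    ENNReal.pow_ne_top (((hw τ hτ).blockFn j).memLp_two).eLpNorm_ne_top
  have hRtop : R ≠ ∞ := ENNReal.add_ne_top.2 ⟨ENNReal.pow_ne_top (ENNReal.mul_ne_top (ENNReal.mul_ne_top
      (ENNReal.pow_ne_top ENNReal.coe_ne_top) ENNReal.coe_ne_top) ENNReal.coe_ne_top),
      ENNReal.pow_ne_top (ENNReal.mul_ne_top ENNReal.coe_ne_top ENNReal.coe_ne_top)⟩
  have hytop : ∀ τ ∈ Icc s t, ∑' j : ℤ, W j * blockL2 (u τ) j ^ 2 ≠ ∞ := fun τ hτ =>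
    tsum_weighted_sq_ne_top (hw τ hτ) hκ1 hκ5
  have hFc : ∀ L, ContinuousOn (F L) (Icc s t) := by
    intro L
    refine continuousOn_finsetSum _ fun j _ => ?_
    have h1 : ContinuousOn (fun τ => W j * blockL2 (u τ) j ^ 2) (Icc s t) :=
      (ENNReal.continuous_const_mul (hWtop j)).comp_continuousOn
        ((continuousOn_blockL2_sq hν hT hmax hLH j).mono hsub)
    exact ENNReal.continuousOn_toReal.comp h1 fun τ hτ => ENNReal.mul_ne_top (hWtop j) (haj τ hτ j)
  have hclose : ∀ L τ, τ ∈ Icc s t → dist (Y τ) (F L τ) ≤ ((2⁻¹ : ℝ≥0∞) ^ L * R).toReal := by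
    intro L τ hτ
    set yL : ℝ≥0∞ := ∑ j ∈ Finset.Icc (-(L : ℤ)) L, W j * blockL2 (u τ) j ^ 2 with hyL
    have hyLtop : yL ≠ ∞ := ENNReal.sum_ne_top.2 fun j _ => ENNReal.mul_ne_top (hWtop j) (haj τ hτ j)
    have hFL : F L τ = yL.toReal := by
      rw [hyL, ENNReal.toReal_sum fun j _ => ENNReal.mul_ne_top (hWtop j) (haj τ hτ j)]
    have hlow : yL ≤ ∑' j : ℤ, W j * blockL2 (u τ) j ^ 2 := ENNReal.sum_le_tsum _
    have hup : ∑' j : ℤ, W j * blockL2 (u τ) j ^ 2 ≤ yL + (2⁻¹ : ℝ≥0∞) ^ L * R :=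
      tsum_weighted_sq_le_window_add (hw τ hτ) (by exact_mod_cast (hSE τ hτ).1) (by exact_mod_cast (hSE τ hτ).2)
        hκ1 hκ5 L
    have h1 : yL.toReal ≤ Y τ := ENNReal.toReal_mono (hytop τ hτ) hlow
    have h2 : Y τ ≤ yL.toReal + ((2⁻¹ : ℝ≥0∞) ^ L * R).toReal := by
      rw [hY]
      simp only
      rw [← ENNReal.toReal_add hyLtop (ENNReal.mul_ne_top (ENNReal.pow_ne_top (by norm_num)) hRtop)]
      exact ENNReal.toReal_mono (ENNReal.add_ne_top.2 ⟨hyLtop,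
        ENNReal.mul_ne_top (ENNReal.pow_ne_top (by norm_num)) hRtop⟩) hup
    rw [hFL, Real.dist_eq, abs_of_nonneg (by linarith)]
    linarith
  have hρ : Tendsto (fun L : ℕ => ((2⁻¹ : ℝ≥0∞) ^ L * R).toReal) atTop (𝓝 0) := by
    have h4 : Tendsto (fun L : ℕ => (2⁻¹ : ℝ≥0∞) ^ L) atTop (𝓝 0) :=
      ENNReal.tendsto_pow_atTop_nhds_zero_of_lt_one (by norm_num)
    have h5 := ENNReal.Tendsto.mul_const h4 (Or.inr hRtop)
    rw [zero_mul] at h5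
    have h6 := (ENNReal.tendsto_toReal ENNReal.zero_ne_top).comp h5
    rwa [ENNReal.toReal_zero] at h6
  have hunif : TendstoUniformlyOn F Y atTop (Icc s t) := by
    refine Metric.tendstoUniformlyOn_iff.2 fun ε hε => ?_
    filter_upwards [(tendsto_order.1 hρ).2 ε hε] with L hL τ hτ
    exact (hclose L τ hτ).trans_lt hL
  exact hunif.continuousOn (Eventually.of_forall hFc).frequently

/-! ## The integrated Riccati inequality at weight `κ` -/

/-- **THE RICCATI INEQUALITY OF THE `Ḃ^{κ/2}_{2,2}` ROW, `3 < κ < 5` (Cheskidov–Zaya 2016, Remark 2.3, integrated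
form).** There is `K = K_κ > 0` such that for every `ν > 0`, `T > 0`, every maximal smooth solution `(u, p)` of the
unforced Navier–Stokes system on `ℝ³ × [0, T)` which is Leray–Hopf from `u 0`, and all `0 < s ≤ t < T`:
`Y(t) − Y(s) ≤ K ν^{−(5−κ)/(κ−1)} ∫_s^t Y(τ)^{(κ+1)/(κ−1)} dτ`, `Y(τ) = ∑_{j∈ℤ} 2^{κj} ‖Δ̇_j u(τ)‖₂²`.
Proof: as `RiccatiInequality.besov32_two_point` with the slice bound `RiccatiSliceGen.weighted_slice_le_gen` (uniform
fourth-order data `exists_fourthSum_le`), the signed block balances × `2^{κj}` summed over `|j| ≤ L`, integration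
(`Y` continuous, `continuousOn_row`) and `L → ∞`. [cite: CheskidovZaya2016, Remark 2.3 (p. 6)] -/
theorem row_two_point_gen {κ : ℝ} (hκ3 : 3 < κ) (hκ5 : κ < 5) :
    ∃ K : ℝ, 0 < K ∧ ∀ (ν T : ℝ), 0 < ν → 0 < T →
      ∀ (u : ℝ → EuclideanSpace ℝ (Fin 3) → EuclideanSpace ℝ (Fin 3)) (p : ℝ → EuclideanSpace ℝ (Fin 3) → ℝ),
      IsMaximalSmoothSolution ν 0 u p T → IsLerayHopfOn T ν 0 (u 0) u →
      ∀ s t : ℝ, 0 < s → s ≤ t → t < T →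
        (∑' j : ℤ, (2 : ℝ≥0∞) ^ (κ * (j : ℝ)) * blockL2 (u t) j ^ 2).toReal -
            (∑' j : ℤ, (2 : ℝ≥0∞) ^ (κ * (j : ℝ)) * blockL2 (u s) j ^ 2).toReal ≤
          K * ν ^ (-((5 - κ) / (κ - 1))) *
            ∫ τ in s..t, ((∑' j : ℤ, (2 : ℝ≥0∞) ^ (κ * (j : ℝ)) * blockL2 (u τ) j ^ 2).toReal) ^ ((κ + 1) / (κ - 1)) := by
  obtain ⟨K₁, hK₁, hslice⟩ := weighted_slice_le_gen hκ3 hκ5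
  refine ⟨2 * K₁, by positivity, fun ν T hν hT u p hmax hLH s t hs hst htT => ?_⟩
  set K := lpBounds (Fin 3) with hK
  obtain ⟨S₄, E₀, hSE⟩ := exists_fourthSum_le hν hT hmax hLH hs hst htT
  set pw : ℝ := (κ + 1) / (κ - 1) with hpw
  have hpw0 : 0 < pw := by rw [hpw]; exact div_pos (by linarith) (by linarith)
  set νβ : ℝ := ν ^ (-((5 - κ) / (κ - 1))) with hνβ
  have hνβ0 : 0 ≤ νβ := Real.rpow_nonneg hν.le _
  set W : ℤ → ℝ≥0∞ := fun j => (2 : ℝ≥0∞) ^ (κ * (j : ℝ)) with hW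
  set R : ℝ≥0∞ := ((K.Cr : ℝ≥0∞) ^ 4 * K.C₂ * S₄) ^ 2 + (K.C₂ * E₀) ^ 2 with hR
  set ε : ℝ := ν / (3 * (K.Cr : ℝ) ^ 2 + 1) with hε
  set Y : ℝ → ℝ := fun τ => (∑' j : ℤ, W j * blockL2 (u τ) j ^ 2).toReal with hY
  set F : ℕ → ℝ → ℝ := fun L τ =>
    ∑ j ∈ Finset.Icc (-(L : ℤ)) L, (W j).toReal * (blockL2 (u τ) j ^ 2).toReal with hF
  set g : ℤ → ℝ → ℝ := fun j τ =>
    -ν * (∑ i, ∫ x, ‖fderiv ℝ (blockFn j (u τ)) x (stdOrthonormalBasis ℝ (EuclideanSpace ℝ (Fin 3)) i)‖ ^ 2) -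
      ∫ x, ⟪blockFn j (u τ) x, blockFn j (convect (u τ) (u τ)) x⟫ with hg
  have hsub : Icc s t ⊆ Ioo 0 T := fun τ hτ => ⟨hs.trans_le hτ.1, hτ.2.trans_lt htT⟩
  have hw : ∀ τ ∈ Icc s t, IsSmoothL2Field (u τ) := fun τ hτ =>
    isSmoothL2Field_slice_of_maximal hν hT hmax hLH (hsub hτ)
  have hdiv : ∀ τ ∈ Icc s t, VectorCalculus.IsDivFree (u τ) := fun τ hτ =>
    hmax.1.divFree τ ⟨(hsub hτ).1.le, (hsub hτ).2⟩
  have hWtop : ∀ j, W j ≠ ∞ := fun j => RiccatiSlice.two_rpow_ne_top _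
  have haj : ∀ τ ∈ Icc s t, ∀ j, blockL2 (u τ) j ^ 2 ≠ ∞ := fun τ hτ j =>
    ENNReal.pow_ne_top (((hw τ hτ).blockFn j).memLp_two).eLpNorm_ne_top
  have hRtop : R ≠ ∞ := ENNReal.add_ne_top.2 ⟨ENNReal.pow_ne_top (ENNReal.mul_ne_top (ENNReal.mul_ne_top
      (ENNReal.pow_ne_top ENNReal.coe_ne_top) ENNReal.coe_ne_top) ENNReal.coe_ne_top),
      ENNReal.pow_ne_top (ENNReal.mul_ne_top ENNReal.coe_ne_top ENNReal.coe_ne_top)⟩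
  have hytop : ∀ τ ∈ Icc s t, ∑' j : ℤ, W j * blockL2 (u τ) j ^ 2 ≠ ∞ := fun τ hτ =>
    tsum_weighted_sq_ne_top (hw τ hτ) (by linarith) (by linarith)
  have hYc : ContinuousOn Y (Icc s t) := continuousOn_row (by linarith) hκ5.le hν hT hmax hLH hs hst htT
  have hY0 : ∀ τ, 0 ≤ Y τ := fun τ => ENNReal.toReal_nonneg
  have hYpw : IntervalIntegrable (fun τ => Y τ ^ pw) volume s t := by
    refine ContinuousOn.intervalIntegrable ?_
    rw [uIcc_of_le hst]
    exact hYc.rpow_const fun τ _ => Or.inr hpw0.le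
  -- the block balances and their integrability
  have hgint : ∀ j, IntervalIntegrable (g j) volume s t := fun j => by
    obtain ⟨hN, hS, -⟩ := blockL2_sq_toReal_sub_eq hν hT hmax hLH hs hst htT j
    exact (hS.const_mul (-ν)).sub hN
  have hE : ∀ j, (blockL2 (u t) j ^ 2).toReal - (blockL2 (u s) j ^ 2).toReal = 2 * ∫ τ in s..t, g j τ := fun j =>
    (blockL2_sq_toReal_sub_eq hν hT hmax hLH hs hst htT j).2.2
  -- Step 1: the inequality at level `L`
  have hL : ∀ L : ℕ, F L t - F L s ≤
      2 * ((t - s) * (ε * ((2⁻¹ : ℝ≥0∞) ^ L * R).toReal) + K₁ * νβ * ∫ τ in s..t, Y τ ^ pw) := by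
    intro L
    set I : Finset ℤ := Finset.Icc (-(L : ℤ)) L with hI
    have hid : F L t - F L s = 2 * ∫ τ in s..t, ∑ j ∈ I, (W j).toReal * g j τ := by
      show (∑ j ∈ I, (W j).toReal * (blockL2 (u t) j ^ 2).toReal) -
          ∑ j ∈ I, (W j).toReal * (blockL2 (u s) j ^ 2).toReal = _
      rw [← Finset.sum_sub_distrib, intervalIntegral.integral_finsetSum fun j _ => (hgint j).const_mul _,
        Finset.mul_sum]
      refine Finset.sum_congr rfl fun j _ => ?_
      rw [← mul_sub, hE j, intervalIntegral.integral_const_mul]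
      ring
    have hint : IntervalIntegrable (fun τ => ∑ j ∈ I, (W j).toReal * g j τ) volume s t :=
      (IntervalIntegrable.sum I fun j _ => (hgint j).const_mul ((W j).toReal)).congr fun τ _ => by
        simp only [Finset.sum_apply]
    have hint' : IntervalIntegrable (fun τ => ε * ((2⁻¹ : ℝ≥0∞) ^ L * R).toReal + K₁ * νβ * Y τ ^ pw) volume s t :=
      intervalIntegrable_const.add (hYpw.const_mul _)
    have hbound : ∀ τ ∈ Icc s t, ∑ j ∈ I, (W j).toReal * g j τ ≤
        ε * ((2⁻¹ : ℝ≥0∞) ^ L * R).toReal + K₁ * νβ * Y τ ^ pw := fun τ hτ =>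
      hslice ν hν (u τ) (hw τ hτ) (hdiv τ hτ) S₄ E₀ (hSE τ hτ).1 (hSE τ hτ).2 L
    have hmono := intervalIntegral.integral_mono_on hst hint hint' hbound
    rw [hid]
    rw [intervalIntegral.integral_add intervalIntegrable_const (hYpw.const_mul _), intervalIntegral.integral_const,
      intervalIntegral.integral_const_mul, smul_eq_mul] at hmono
    linarith
  -- Step 2: `L → ∞`
  have hlimF : ∀ τ ∈ Icc s t, Tendsto (fun L : ℕ => F L τ) atTop (𝓝 (Y τ)) := by
    intro τ hτ
    have h1 : ∀ L : ℕ, F L τ = (∑ j ∈ Finset.Icc (-(L : ℤ)) L, W j * blockL2 (u τ) j ^ 2).toReal := by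
      intro L
      rw [ENNReal.toReal_sum fun j _ => ENNReal.mul_ne_top (hWtop j) (haj τ hτ j)]
      exact Finset.sum_congr rfl fun j _ => (ENNReal.toReal_mul).symm
    simp_rw [h1]
    exact (ENNReal.tendsto_toReal (hytop τ hτ)).comp (tendsto_sum_Icc_atTop _)
  have hρ : Tendsto (fun L : ℕ => ((2⁻¹ : ℝ≥0∞) ^ L * R).toReal) atTop (𝓝 0) := by
    have h4 : Tendsto (fun L : ℕ => (2⁻¹ : ℝ≥0∞) ^ L) atTop (𝓝 0) :=
      ENNReal.tendsto_pow_atTop_nhds_zero_of_lt_one (by norm_num)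
    have h5 := ENNReal.Tendsto.mul_const h4 (Or.inr hRtop)
    rw [zero_mul] at h5
    have h6 := (ENNReal.tendsto_toReal ENNReal.zero_ne_top).comp h5
    rwa [ENNReal.toReal_zero] at h6
  have hlim := le_of_tendsto_of_tendsto ((hlimF t ⟨hst, le_rfl⟩).sub (hlimF s ⟨le_rfl, hst⟩))
    (((tendsto_const_nhds.mul (hρ.const_mul ε)).add tendsto_const_nhds).const_mul 2) (Eventually.of_forall hL)
  have e : 2 * ((t - s) * (ε * 0) + K₁ * νβ * ∫ τ in s..t, Y τ ^ pw) = 2 * K₁ * νβ * ∫ τ in s..t, Y τ ^ pw := by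
    ring
  exact hlim.trans_eq e

end Summit.NavierStokesRegularity.FluidComputer.RiccatiInequalityGen

end
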